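import Mathlib
import Summits.ResolutionOfSingularities.ResolutionOfSingularities.Theorems.WeightedInvariantLocalWeightedDropTOT2E1Decorated

/-!
# `LocalWeightedDrop`, TOT2-LINE piece S-E0, DECORATED: from a state whose product `g = f · ∏_{l∈O} x_l` has an APEX-FREE degree-`c` form
# the identity point blow-up drops the head at every answer

Route `ResolutionOfSingularities/WeightedInvariant`, engine crux `LocalWeightedDrop` (stmt-ResolutionOfSingularities-8899), chain w43
[OURS · L1 W4.3 · TOT2-LINE v1.1 §(E) S-E0 in the `hhigh` currency of res-L1-w43-stub-1's S-ASM OUTER (`…NCResPhaseAssembly`): the regime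
`e^O = 0` (CJS: no near point at all, Thm 2.14 with `Dir^O = 0`), decorated; res-type-056 on top of res-L1-w43-stub-3's
`TOT2Near.order_slice_lt_of_apexTrivial` and the product bookkeeping of `…TOT2E1Decorated`].  Nothing here is a statement of any manuscript.
No definitions.

* `dWinsTo_headDrop_of_apexFree` — `(b, δ)` admissible (any `o`), the degree-`c` form of `f · ∏_{l ∈ O} x_l` has no non-zero
  translation-invariance vector ⇒ `DWinsTo Prod.fst (fun τ => Admissible τ.1 τ.2 ∧ τ.2.head < δ.head) (b, δ)` (one identity point blow-up;
  a successor with the same head would be the slice of the product's strict transform, of order `c`, which the apex-free form forbids).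
* `dWinsTo_headDrop_of_apexLEOne` — the `e^O ≤ 1` regimes in one call (`hcol` + isolation ⇒ head drop), for the inner S-ASM case split.
-/

set_option linter.dupNamespace false -- mandated namespace of this single-conjunct summit

noncomputable section

namespace Summit.ResolutionOfSingularities.ResolutionOfSingularities.Theorems

open Literature.AlgebraicGeometry.Resolution

namespace TOT2E1

open MvPowerSeries AxisPolyhedron TameFourTupleDrop

variable {k : Type} [Field k] {m : ℕ}

/-- **S-E0, DECORATED**: if the degree-`c` form of the product `f · ∏_{l ∈ O} x_l` of an admissible state with `2 ≤ o` is APEX-FREE, the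
identity point blow-up leads at every answer to an admissibly decorated state with smaller head (no hypothesis on `o`). -/
theorem dWinsTo_headDrop_of_apexFree {b : MvPowerSeries (Fin (m + 1)) k} {δ : Decoration k m} (hadm : Admissible b δ)
    (hAF : ∀ v : Fin (m + 1) → k,
      (∀ x, CobordantChart.initEval (fun _ : Fin (m + 1) => 1) (x + v) δ.c (δ.f * ∏ l ∈ δ.O, X l) =
        CobordantChart.initEval (fun _ : Fin (m + 1) => 1) x δ.c (δ.f * ∏ l ∈ δ.O, X l)) → v = 0) :
    DWinsTo (St := MvPowerSeries (Fin (m + 1)) k × Decoration k m) Prod.fst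
      (fun τ => Admissible τ.1 τ.2 ∧ τ.2.head < δ.head) (b, δ) := by
  classical
  refine DWinsTo.of_measure ({(b, δ)} : Set (MvPowerSeries (Fin (m + 1)) k × Decoration k m)) (fun _ => (0 : Ordinal.{0})) ?_
    (Set.mem_singleton _)
  rintro τ hτ -
  rw [Set.mem_singleton_iff] at hτ
  subst hτ
  have hf : δ.f ≠ 0 := hadm.2.1.ne_zero
  have hperm := isBPermissible_point_X (k := k) δ
  have hconv : ∀ l : Fin (m + 1), (fun _ : Fin (m + 1) => (1 : ℕ)) l = 0 → (fun _ => (0 : k)) l = 0 := fun l hl => absurd hl one_ne_zero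
  refine ⟨fun j => X j, fun _ => 1, hperm.1, ?_⟩
  intro c _ hc0 A G hfac hG
  have hc : ∀ l : Fin (m + 1), (fun _ : Fin (m + 1) => (1 : ℕ)) l = 0 → c l = 0 := fun l hl => absurd hl one_ne_zero
  obtain ⟨i, hci⟩ : ∃ i, c i ≠ 0 := Function.ne_iff.mp hc0
  set δ' := δ.transform (fun j => (X j : MvPowerSeries (Fin (m + 1)) k)) (fun _ => 1) c i with hδ'
  have hadm' : Admissible (X 0 * TupleGame.slice i G) δ' := admissible_transform hadm hperm hc hfac hG hci
  have hhead' : δ'.head ≤ δ.head := Decoration.head_transform_le hperm hc hf hci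
  refine ⟨i, hci, (X 0 * TupleGame.slice i G, δ'), rfl, Or.inl ⟨hadm', ?_⟩⟩
  by_contra hlt
  have heq : δ'.head = δ.head := le_antisymm hhead' (not_lt.mp hlt)
  -- with the same head the new product would be the slice of the product's strict transform, of order `c`
  have hid := totalO_transform_eq_slice hadm hci heq
  have hordd : (TupleGame.slice i (satPart (δ.fChart (fun j => (X j : MvPowerSeries (Fin (m + 1)) k)) (fun _ => 1) c) *
      ∏ l ∈ δ.O, (C (c l) + X l.succ))).order = δ.c := by
    rw [← hid]
    exact order_totalO_transform hadm hfac hG hci heq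
  have hlt' := TOT2Near.order_slice_lt_of_apexTrivial (δ.f * ∏ l ∈ δ.O, X l) hAF c i hci (chart_totalO_eq hadm c)
  rw [hordd] at hlt'
  exact lt_irrefl _ hlt'

/-- **THE `e ≤ 1` REGIMES IN ONE CALL** (S-E0 ∪ S-E1, `hhigh` currency): `(b, δ)` admissible with `2 ≤ o`; every two translation-invariance
vectors of the degree-`c` form of the product `g = f · ∏_{l ∈ O} x_l` are linearly dependent (`e^O ≤ 1`); and no formal coordinate change
makes `g` equimultiple along the axis (isolation; vacuous bookkeeping when `e^O = 0`).  Then the mover forces an admissibly decorated state with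
smaller head: apex-free ⇒ `dWinsTo_headDrop_of_apexFree`, else the apex is a line ⇒ `dWinsTo_headDrop_of_isolated`. -/
theorem dWinsTo_headDrop_of_apexLEOne [Infinite k] {b : MvPowerSeries (Fin (m + 1)) k} {δ : Decoration k m}
    (hadm : Admissible b δ) (ho : 2 ≤ δ.o)
    (hcol : ∀ v₁ v₂ : Fin (m + 1) → k,
      (∀ x : Fin (m + 1) → k, CobordantChart.initEval (fun _ : Fin (m + 1) => 1) (x + v₁) δ.c (δ.f * ∏ l ∈ δ.O, X l) =
        CobordantChart.initEval (fun _ : Fin (m + 1) => 1) x δ.c (δ.f * ∏ l ∈ δ.O, X l)) →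
      (∀ x : Fin (m + 1) → k, CobordantChart.initEval (fun _ : Fin (m + 1) => 1) (x + v₂) δ.c (δ.f * ∏ l ∈ δ.O, X l) =
        CobordantChart.initEval (fun _ : Fin (m + 1) => 1) x δ.c (δ.f * ∏ l ∈ δ.O, X l)) →
      ∃ α β : k, (α ≠ 0 ∨ β ≠ 0) ∧ α • v₁ + β • v₂ = 0)
    (hisol : ∀ Φ : Fin (m + 1) → MvPowerSeries (Fin (m + 1)) k, (∀ l, constantCoeff (Φ l) = 0) →
      IsUnit (Matrix.det (Matrix.of fun a j : Fin (m + 1) => coeff (Finsupp.single j 1) (Φ a))) →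
      ¬ InAxisIdeal δ.c (subst Φ (δ.f * ∏ l ∈ δ.O, X l))) :
    DWinsTo (St := MvPowerSeries (Fin (m + 1)) k × Decoration k m) Prod.fst
      (fun τ => Admissible τ.1 τ.2 ∧ τ.2.head < δ.head) (b, δ) := by
  by_cases hone : ∃ v : Fin (m + 1) → k, v ≠ 0 ∧ ∀ x : Fin (m + 1) → k,
      CobordantChart.initEval (fun _ : Fin (m + 1) => 1) (x + v) δ.c (δ.f * ∏ l ∈ δ.O, X l) =
        CobordantChart.initEval (fun _ : Fin (m + 1) => 1) x δ.c (δ.f * ∏ l ∈ δ.O, X l)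
  · exact dWinsTo_headDrop_of_isolated hadm ho hone hcol hisol
  · push Not at hone
    exact dWinsTo_headDrop_of_apexFree hadm fun v hv => by
      by_contra hv0
      obtain ⟨x, hx⟩ := hone v hv0
      exact hx (hv x)

end TOT2E1

end Summit.ResolutionOfSingularities.ResolutionOfSingularities.Theorems

end
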